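import Literature.Barriers.HubbardSuperconductivity.SignProblemNPHardProofs
import Literature.Computability.Complexity.FoldBricks
import Literature.Computability.Complexity.IntMatrixBricks
import Literature.Computability.Complexity.PlumbingBricks
import HarnessLib

/-!
# Discharge of Troyer–Wiese's reduction step `signProblem_decides_isingGround`: `ISINGGROUND ∈ P^O`

Sibling proof file of `SignProblemNPHard.lean` (D-0014), on top of `SignProblemNPHardProofs.lean`
(which discharges the barrier itself through the CNF-coded language `SatIsing` and leaves the named
fact about the matrix-coded language `ISINGGROUND` open): it proves
`signProblem_decides_isingGround_holds : signProblem_decides_isingGround`, i.e.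
`∀ O, IsIsingThermalOracle O → ISINGGROUND ∈ P^O`, and the corollary
`SignProblemNPHard.of_isingGround_isNPComplete` (the barrier along Troyer–Wiese's own route, from the
one remaining named fact `isingGround_isNPComplete`). Troyer–Wiese [cite: TroyerWiese2005, Letter p. 4]:
"This question whether there is a state with energy `E(c) ≤ E₀` can also be answered … by calculating the average
energy of the spin glass at a large enough inverse temperature `β` … `βJ ≥ N ln 2 + ln(12N)`". The
tree's language `ISINGGROUND = (encodingIntMatrix.pairBool encodingIntBool).toLanguage isingGroundSet`
is the IMAGE of the yes-instances under the instance encoding, so a polynomial-time decision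
procedure must, besides asking the thermal energy, RECOGNISE CODEWORDS (strings
`⟨⟨bin n, ⟨1^{n²}, body [entry codes]⟩⟩, code K⟩` with canonical numerals, exactly `n²` entries, each
the sign–magnitude code of `0` or `±1`). This file builds both in the tree's algebra of `FP` string
functions (`comp_mem_FP`, `fanoutFn`, `iteFn`, records `Brick.fstF`/`sndF`/`sndPow`, the indexed fold
`Brick.foldLoop` of `FoldBricks.lean`, the integer bricks `ofSMFn`/`smval`/`zcanonF`/`signMagOfZF`/
`zaddF`/`zmulF`/`zleF` of `IntPairBricks.lean`/`ZIntBricks.lean`, `binToUnaryFn`, `HashBricks.umulFn`,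
`lenBinF`, `Plumb.polyFn`, `PRelSigPi.elemFn`, `eqPairFn`) — no machine is written by hand — by
the method of RE-ENCODING A TOTAL PARSE:

* **The total parse** of an arbitrary string `x = ⟨⟨N, ⟨U, F⟩⟩, B⟩` (all projections by the total
  pair decoder): dimension `dimOf x = min ⟦N⟧ |x|` (the cap keeps everything polynomial and is
  inactive on codewords, `le_length_isingCode`, `dimOf_isingCode`), entries `entryOf x k = sign (smval (elemOf F k))`
  (item `k` of `F` read in sign–magnitude and CLAMPED to a unit coupling; `ε ↦ 0` past the end),
  the matrix `matOf x` (row-major, `IsUnitCoupling` always: `isUnitCoupling_matOf`) and the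
  threshold `thrOf x = smval B`.
* **The re-encoder** `reencF ∈ FP` with `reencF x = isingCode (⟨dimOf x, matOf x⟩, thrOf x)` on
  EVERY string (`reencF_apply`): the matrix code `matCodeF` (`⟨bin n', ⟨1^{n'²}, body⟩⟩`, the body
  being the concatenation fold `entryBodyF` of the `n'²` framed clamped entry codes `entryPieceF`, `|x|²`
  rounds), the threshold code `thrCodeF = signMagOfZF ∘ zcanonF ∘ ofSMFn ∘ sndF`; and
  `encodingIntMatrix_encode_eq`, the flat form of the tree's matrix encoding
  (`Literature.Algebra.EuclideanLattices.encodingIntMatrixFin`: `finProdFinEquiv`-row-major `List.ofFn`).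
* **Codewords are the fixed points of the re-encoder**: `reencF_isingCode` (a codeword of a
  unit-coupling instance parses to itself) and conversely every value of `reencF` is such a codeword,
  whence `mem_ISINGGROUND_iff : x ∈ ISINGGROUND ↔ reencF x = x ∧ ∃ σ, E_{matOf x}(σ) ≤ thrOf x`.
* **The query** `igQryF x = thermalQuery ⟨dimOf x, matOf x⟩ (3|x| + 3) 3` (`igQryF_apply`) — a
  legal query of a thermal oracle on every input (unit couplings; `3|x| + 3 ≥ 3n' + 3 ≥
  n' ln 2 + ln 12n'`) — and **the decision** `igDecF ⟨x, a⟩ = [reencF x = x ∧ smval a ≤ 4 thrOf x + 2]`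
  (`igDecF_boolPair`; `a/4 < K' + 3/4`), both in `FP`.
* **The oracle algorithm** `igAlg` (ask `igQryF x`, output the decision on the answer): `run_igAlg`,
  `eq_of_mem_queries_igAlg`, and `isPolyTime_igAlg` (its step as the `FP` string map `igStepB`, the
  pattern of `signAlg` in `SignProblemNPHardProofs.lean`).
* **The verdict** `igVerdict_eq_boolIndicator`: for a thermal oracle the decision bit is
  `[x ∈ ISINGGROUND]` — the oracle's answer `a` has `|a/4 - ⟨H_{J'}⟩_β| ≤ 1/4` at `β = 3|x| + 3`, and
  Troyer–Wiese's low-temperature lemma `lowTemperature_thermalEnergy_decides_holds` (with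
  `lowTemperature_le`: `3n' + 3 ≥ n' ln 2 + ln 12n'`) gives `a ≤ 4K' + 2 ↔ ∃ σ, E_{J'}(σ) ≤ K'`;
  hence `isingGround_mem_PRel : ISINGGROUND ∈ P^O` and **`signProblem_decides_isingGround_holds`**.

## References

* M. Troyer, U.-J. Wiese, *Computational complexity and fundamental limitations to fermionic quantum
  Monte Carlo simulations*, PRL 94 (2005) 170201, Letter p. 4 (the reduction step).
* S. Arora, B. Barak, *Computational Complexity: A Modern Approach*, CUP 2009, §0.1 (representing
  objects as strings; a decision problem is the set of codes of its yes-instances), §1.3 (polynomial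
  time is closed under composition and polynomially bounded loops), §3.4 (oracle machines).
-/

noncomputable section

namespace Literature.Barriers.HubbardSuperconductivity

open _root_.Computability Literature.Computability.Complexity Brick OracleCompose PRelSigPi Polynomial

namespace IsingCode

/-! ### Row-major flattening and the shape of the instance code -/

/-- Entry `k` of the row-major flattening of an `n × n` matrix (`0` past the end): the entry list
written by `encodingIntMatrixFin`. [cite: AroraBarak2009, §0.1] -/
def flatEntry {n : ℕ} (J : Matrix (Fin n) (Fin n) ℤ) (k : ℕ) : ℤ :=
  if h : k < n * n then J (finProdFinEquiv.symm ⟨k, h⟩).1 (finProdFinEquiv.symm ⟨k, h⟩).2 else 0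

/-- `flatEntry J (i n + j) = J i j`. [folklore] -/
theorem flatEntry_mul_add {n : ℕ} (J : Matrix (Fin n) (Fin n) ℤ) (i j : Fin n) :
    flatEntry J (i * n + j) = J i j := by
  have hlt : (i : ℕ) * n + j < n * n := by
    have hi := i.isLt; have hj := j.isLt
    calc (i : ℕ) * n + j < i * n + n := by omega
      _ = (i + 1) * n := by ring
      _ ≤ n * n := Nat.mul_le_mul_right n (by omega)
  unfold flatEntry
  rw [dif_pos hlt]
  have h : finProdFinEquiv.symm (⟨(i : ℕ) * n + j, hlt⟩ : Fin (n * n)) = (i, j) := by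
    rw [Equiv.symm_apply_eq]
    exact Fin.ext (by simp [Nat.mul_comm]; ring)
  rw [h]

/-- **The instance code, flat**: `code ⟨n, J⟩ = ⟨bin n, ⟨1^{n²}, body [code (flatEntry J k) | k < n²]⟩⟩`.
[cite: AroraBarak2009, §0.1] -/
theorem encodingIntMatrix_encode_eq (n : ℕ) (J : Matrix (Fin n) (Fin n) ℤ) :
    encodingIntMatrix.encode ⟨n, J⟩ =
      boolPair (encodeNat n) (boolPair (ones (n * n))
        (body ((List.range (n * n)).map fun k => encodingIntBool.encode (flatEntry J k)))) := by
  rw [encodingIntMatrix_encode]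
  congr 1
  change (encodingFinVec encodingIntBool (n * n)).encode
      (fun k => J (finProdFinEquiv.symm k).1 (finProdFinEquiv.symm k).2) = _
  change encodingIntBool.listBool.encode (List.ofFn _) = _
  rw [CNFIsing.listBool_encode_eq_boolPair, List.length_ofFn]
  congr 2
  rw [List.ofFn_eq_map, ← List.map_coe_finRange_eq_range, List.map_map, List.map_map]
  congr 1
  funext k
  simp only [Function.comp_apply, flatEntry, dif_pos k.isLt]

/-! ### The total parse of an input string -/

/-- The dimension read off `x`: `min ⟦N⟧ |x|` for the binary header `N = fstF (fstF x)` (the cap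
keeps every downstream loop polynomial; on a codeword it is inactive). [folklore] -/
def dimOf (x : List Bool) : ℕ := min (bitsToNat (fstF (fstF x))) x.length

/-- The framed entry list read off `x`. [folklore] -/
def entriesOf (x : List Bool) : List Bool := sndF (sndF (fstF x))

/-- Entry `k` read off `x`, CLAMPED to a unit coupling: the sign of the sign–magnitude value of
item `k` of the entry list. [folklore] -/
def entryOf (x : List Bool) (k : ℕ) : ℤ := Int.sign (smval (elemOf (entriesOf x) k))

/-- The unit-coupling matrix read off `x`. [folklore] -/
def matOf (x : List Bool) : Matrix (Fin (dimOf x)) (Fin (dimOf x)) ℤ :=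
  fun i j => entryOf x (i * dimOf x + j)

/-- The threshold read off `x`. [folklore] -/
def thrOf (x : List Bool) : ℤ := smval (sndF x)

/-- The code of an instance `(⟨n, J⟩, K)` of the Ising ground-state problem (the encoding of
`ISINGGROUND`). [cite: TroyerWiese2005, Letter p. 4] -/
def isingCode (p : (Σ n, Matrix (Fin n) (Fin n) ℤ) × ℤ) : List Bool :=
  (encodingIntMatrix.pairBool encodingIntBool).encode p

/-- Every clamped entry is `0` or `±1`. [folklore] -/
theorem entryOf_mem (x : List Bool) (k : ℕ) : entryOf x k = 0 ∨ entryOf x k = 1 ∨ entryOf x k = -1 := by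
  unfold entryOf
  rcases lt_trichotomy (smval (elemOf (entriesOf x) k)) 0 with h | h | h
  · exact Or.inr (Or.inr (Int.sign_eq_neg_one_of_neg h))
  · exact Or.inl (by rw [h]; rfl)
  · exact Or.inr (Or.inl (Int.sign_eq_one_of_pos h))

/-- **The parsed matrix has unit couplings**, whatever `x` is. [folklore] -/
theorem isUnitCoupling_matOf (x : List Bool) : IsUnitCoupling (matOf x) := fun _ _ => entryOf_mem x _

/-- The flattening of the parsed matrix is the entry reader. [folklore] -/
theorem flatEntry_matOf (x : List Bool) {k : ℕ} (hk : k < dimOf x * dimOf x) : flatEntry (matOf x) k = entryOf x k := by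
  unfold flatEntry matOf
  rw [dif_pos hk]
  simp only [finProdFinEquiv_symm_apply, Fin.coe_divNat, Fin.coe_modNat, Nat.div_add_mod' k (dimOf x)]


/-! ### The re-encoder: dimension, entries, matrix code, threshold code -/

/-- `1^{n'}`: the capped dimension in unary (`binToUnaryFn ⟨x, N⟩`). [folklore] -/
def unF : List Bool → List Bool := binToUnaryFn ∘ fanoutFn id (fstF ∘ fstF)

/-- Value of `unF`. [folklore] -/
@[simp] theorem unF_apply (x : List Bool) : unF x = ones (dimOf x) := by
  simp [unF, dimOf]

/-- `unF ∈ FP`. [folklore] -/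
theorem unF_mem_FP : unF ∈ FP :=
  comp_mem_FP binToUnaryFn_mem_FP (fanoutFn_mem_FP id_mem_FP (comp_mem_FP fstF_mem_FP fstF_mem_FP))

/-- The framed sign–magnitude code `⟨code z, ε⟩`-prefix of an entry `z`, i.e. one item of a `body`.
[cite: AroraBarak2009, §0.1] -/
def frame (z : ℤ) : List Bool := boolPair (encodingIntBool.encode z) []

/-- The framed code of the SIGN of the value of an entry string (three constant strings, selected by
two one-bit sign tests on the difference pair `ofSMFn e`). [folklore] -/
def pieceOfEntry : List Bool → List Bool :=
  iteFn (iposFn ∘ ofSMFn) (fun _ => frame 1)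
    (iteFn (iposFn ∘ zswapF ∘ ofSMFn) (fun _ => frame (-1)) fun _ => frame 0)

/-- **Value of `pieceOfEntry`**: the framed code of `sign (smval e)`, on every string. [folklore] -/
theorem pieceOfEntry_apply (e : List Bool) : pieceOfEntry e = frame (Int.sign (smval e)) := by
  have h1 : (iposFn ∘ ofSMFn) e = [decide (0 < smval e)] := by simp
  have h2 : (iposFn ∘ zswapF ∘ ofSMFn) e = [decide (0 < -smval e)] := by simp
  rw [pieceOfEntry, iteFn_apply h1]
  by_cases hp : 0 < smval e
  · simp [hp, Int.sign_eq_one_of_pos hp]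
  · rw [if_neg (by simpa using hp), iteFn_apply h2]
    by_cases hn : smval e < 0
    · rw [if_pos (by simpa using hn), Int.sign_eq_neg_one_of_neg hn]
    · have h0 : smval e = 0 := by omega
      rw [if_neg (by simp [h0]), h0, Int.sign_zero]

/-- `pieceOfEntry ∈ FP`. [folklore] -/
theorem pieceOfEntry_mem_FP : pieceOfEntry ∈ FP :=
  iteFn_mem_FP (comp_mem_FP iposFn_mem_FP ofSMFn_mem_FP) (const_mem_FP _)
    (iteFn_mem_FP (comp_mem_FP iposFn_mem_FP (comp_mem_FP zswapF_mem_FP ofSMFn_mem_FP)) (const_mem_FP _)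
      (const_mem_FP _))

/-- The three unit frames have at most `12` symbols. [folklore] -/
theorem length_frame_sign_le (z : ℤ) : (frame (Int.sign z)).length ≤ 12 := by
  rcases lt_trichotomy z 0 with h | rfl | h
  · rw [Int.sign_eq_neg_one_of_neg h]; decide
  · decide
  · rw [Int.sign_eq_one_of_pos h]; decide

/-- `|pieceOfEntry e| ≤ 12`. [folklore] -/
theorem length_pieceOfEntry_le (e : List Bool) : (pieceOfEntry e).length ≤ 12 := by
  rw [pieceOfEntry_apply]; exact length_frame_sign_le _

/-- **The piece function of the entry fold**: on `⟨x, 1ᵏ⟩`, the framed code of the clamped entry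
`k` of `x` (item `k` of the entry list, read by `elemFn`). [folklore] -/
def entryPieceF : List Bool → List Bool := pieceOfEntry ∘ elemFn ∘ fanoutFn sndF (sndF ∘ sndF ∘ fstF ∘ fstF)

/-- Value of the piece function. [folklore] -/
theorem entryPieceF_apply (x : List Bool) (k : ℕ) : entryPieceF (boolPair x (ones k)) = frame (entryOf x k) := by
  simp [entryPieceF, elemFn_boolPair, pieceOfEntry_apply, entryOf, entriesOf, ones]

/-- `entryPieceF ∈ FP`. [folklore] -/
theorem entryPieceF_mem_FP : entryPieceF ∈ FP :=
  comp_mem_FP pieceOfEntry_mem_FP (comp_mem_FP elemFn_mem_FP (fanoutFn_mem_FP sndF_mem_FP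
    (comp_mem_FP sndF_mem_FP (comp_mem_FP sndF_mem_FP (comp_mem_FP fstF_mem_FP fstF_mem_FP)))))

/-- Linear (indeed constant) growth of the piece function, on every input. [folklore] -/
theorem length_entryPieceF_le (w : List Bool) : (entryPieceF w).length ≤ 12 * ((fstF w).length + 1) :=
  (length_pieceOfEntry_le _).trans (Nat.le_mul_of_pos_right 12 (Nat.succ_pos _))

/-- The fold's input record `⟨x, ⟨bin n'², ⟨1⁰, ε⟩⟩⟩`. [folklore] -/
def foldInF : List Bool → List Bool :=
  fanoutFn id (fanoutFn (lenBinF ∘ HashBricks.umulFn ∘ fanoutFn unF unF) fun _ => boolPair [] [])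

/-- Value of `foldInF`. [folklore] -/
theorem foldInF_apply (x : List Bool) :
    foldInF x = boolPair x (boolPair (encodeNat (dimOf x * dimOf x)) (boolPair (ones 0) [])) := by
  simp [foldInF, HashBricks.umulFn_apply, ones]

/-- `foldInF ∈ FP`. [folklore] -/
theorem foldInF_mem_FP : foldInF ∈ FP :=
  fanoutFn_mem_FP id_mem_FP (fanoutFn_mem_FP (comp_mem_FP lenBinF_mem_FP (comp_mem_FP HashBricks.umulFn_mem_FP
    (fanoutFn_mem_FP unF_mem_FP unF_mem_FP))) (const_mem_FP _))

/-- **The body of the entry list of the re-encoded matrix**: the concatenation fold of the `n'²`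
framed clamped entries (`foldLoop appF entryPieceF`, `|x|²` rounds available). [folklore] -/
def entryBodyF : List Bool → List Bool := sndPow 2 ∘ foldLoop appF entryPieceF (X ^ 2) ∘ foldInF

/-- `body` of the codes of `g 0, …, g (m-1)` is the concatenation of their frames. [folklore] -/
theorem body_map_range (g : ℕ → ℤ) : ∀ m : ℕ,
    body ((List.range m).map fun k => encodingIntBool.encode (g k)) = ccat (fun k => frame (g k)) m
  | 0 => rfl
  | m + 1 => by
    rw [List.range_succ, List.map_append, List.map_singleton, ccat_succ, ← body_map_range g m]
    induction ((List.range m).map fun k => encodingIntBool.encode (g k)) with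
    | nil => rfl
    | cons a l ih => rw [List.cons_append, body_cons, body_cons, ih, boolPair, boolPair]; simp

/-- **Value of `entryBodyF`**: the body of the row-major list of the clamped entry codes. [folklore] -/
theorem entryBodyF_apply (x : List Bool) :
    entryBodyF x = body ((List.range (dimOf x * dimOf x)).map fun k => encodingIntBool.encode (entryOf x k)) := by
  have hk : dimOf x * dimOf x ≤ (X ^ 2 : Polynomial ℕ).eval x.length := by
    rw [eval_pow, eval_X, sq]
    exact Nat.mul_le_mul (Nat.min_le_right _ x.length) (Nat.min_le_right _ x.length)
  rw [entryBodyF, Function.comp_apply, Function.comp_apply, foldInF_apply, foldLoop_apply appF entryPieceF hk 0 [],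
    foldAcc_appF, body_map_range]
  simp [sndPow, entryPieceF_apply]

/-- `entryBodyF ∈ FP`. [folklore] -/
theorem entryBodyF_mem_FP : entryBodyF ∈ FP :=
  comp_mem_FP (sndPow_mem_FP 2) (comp_mem_FP
    (foldLoop_mem_FP appF_mem_FP length_appF_le entryPieceF_mem_FP length_entryPieceF_le (X ^ 2)) foldInF_mem_FP)

/-- **The matrix code of the parsed instance**: `⟨bin n', ⟨1^{n'²}, body⟩⟩`. [folklore] -/
def matCodeF : List Bool → List Bool :=
  fanoutFn (lenBinF ∘ unF) (fanoutFn (HashBricks.umulFn ∘ fanoutFn unF unF) entryBodyF)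

/-- Value of `matCodeF`, flat form. [folklore] -/
theorem matCodeF_apply' (x : List Bool) :
    matCodeF x = boolPair (encodeNat (dimOf x)) (boolPair (ones (dimOf x * dimOf x))
      (body ((List.range (dimOf x * dimOf x)).map fun k => encodingIntBool.encode (entryOf x k)))) := by
  simp [matCodeF, HashBricks.umulFn_apply, entryBodyF_apply, ones]

/-- **Value of `matCodeF`**: the code of the parsed unit-coupling instance `⟨n', J'⟩`. [folklore] -/
theorem matCodeF_apply (x : List Bool) : matCodeF x = encodingIntMatrix.encode ⟨dimOf x, matOf x⟩ := by
  rw [matCodeF_apply', encodingIntMatrix_encode_eq]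
  congr 3
  refine List.map_congr_left fun k hk => ?_
  rw [flatEntry_matOf x (List.mem_range.1 hk)]

/-- `matCodeF ∈ FP`. [folklore] -/
theorem matCodeF_mem_FP : matCodeF ∈ FP :=
  fanoutFn_mem_FP (comp_mem_FP lenBinF_mem_FP unF_mem_FP)
    (fanoutFn_mem_FP (comp_mem_FP HashBricks.umulFn_mem_FP (fanoutFn_mem_FP unF_mem_FP unF_mem_FP)) entryBodyF_mem_FP)

/-- **The threshold code of the parsed instance**: the canonical sign–magnitude code of `smval (sndF x)`.
[folklore] -/
def thrCodeF : List Bool → List Bool := signMagOfZF ∘ zcanonF ∘ ofSMFn ∘ sndF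

/-- Value of `thrCodeF`. [folklore] -/
theorem thrCodeF_apply (x : List Bool) : thrCodeF x = encodingIntBool.encode (thrOf x) := by
  have h : ∀ z : ℤ, encodingIntBool.encode z = boolPair [decide (z < 0)] (encodeNat z.natAbs) := fun _ => rfl
  simp [thrCodeF, signMagOfZF_dpEnc, h, thrOf]

/-- `thrCodeF ∈ FP`. [folklore] -/
theorem thrCodeF_mem_FP : thrCodeF ∈ FP :=
  comp_mem_FP signMagOfZF_mem_FP (comp_mem_FP zcanonF_mem_FP (comp_mem_FP ofSMFn_mem_FP sndF_mem_FP))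

/-- **The re-encoder**: the code of the parsed instance `(⟨n', J'⟩, K')`. [folklore] -/
def reencF : List Bool → List Bool := fanoutFn matCodeF thrCodeF

/-- **Value of the re-encoder**: on EVERY string, the code of the parsed unit-coupling instance. [folklore] -/
theorem reencF_apply (x : List Bool) : reencF x = isingCode (⟨dimOf x, matOf x⟩, thrOf x) := by
  rw [reencF, fanoutFn_apply, matCodeF_apply, thrCodeF_apply]; rfl

/-- `reencF ∈ FP`. [folklore] -/
theorem reencF_mem_FP : reencF ∈ FP := fanoutFn_mem_FP matCodeF_mem_FP thrCodeF_mem_FP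

/-! ### Codewords are the fixed points of the re-encoder -/

/-- Unfolding `isingCode`. [folklore] -/
theorem isingCode_eq (n : ℕ) (J : Matrix (Fin n) (Fin n) ℤ) (K : ℤ) :
    isingCode (⟨n, J⟩, K) = boolPair (encodingIntMatrix.encode ⟨n, J⟩) (encodingIntBool.encode K) := rfl

/-- The dimension is at most the length of the code. [folklore] -/
theorem le_length_isingCode (n : ℕ) (J : Matrix (Fin n) (Fin n) ℤ) (K : ℤ) :
    n ≤ (isingCode (⟨n, J⟩, K)).length := by
  rw [isingCode_eq, encodingIntMatrix_encode_eq, length_boolPair, length_boolPair, length_boolPair]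
  have : n ≤ n * n := Nat.le_mul_self n
  simp only [ones, List.length_replicate]
  omega

/-- On a unit-coupling matrix the flat entries are `0` or `±1`, hence fixed by `Int.sign`. [folklore] -/
theorem sign_flatEntry {n : ℕ} {J : Matrix (Fin n) (Fin n) ℤ} (hJ : IsUnitCoupling J) (k : ℕ) :
    Int.sign (flatEntry J k) = flatEntry J k := by
  unfold flatEntry
  split_ifs with h
  · generalize finProdFinEquiv.symm ⟨k, h⟩ = ij
    rcases hJ ij.1 ij.2 with h0 | h0 | h0 <;> simp [h0]
  · rfl

/-- The parse of a codeword: dimension. [folklore] -/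
theorem dimOf_isingCode (n : ℕ) (J : Matrix (Fin n) (Fin n) ℤ) (K : ℤ) : dimOf (isingCode (⟨n, J⟩, K)) = n := by
  have h := le_length_isingCode n J K
  rw [dimOf, isingCode_eq, fstF_boolPair, encodingIntMatrix_encode_eq, fstF_boolPair, bitsToNat_encodeNat]
  rw [isingCode_eq, encodingIntMatrix_encode_eq] at h
  exact Nat.min_eq_left h

/-- The parse of a codeword: entries below `n²`. [folklore] -/
theorem entryOf_isingCode {n : ℕ} {J : Matrix (Fin n) (Fin n) ℤ} (hJ : IsUnitCoupling J) (K : ℤ) {k : ℕ}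
    (hk : k < n * n) : entryOf (isingCode (⟨n, J⟩, K)) k = flatEntry J k := by
  rw [entryOf, entriesOf, isingCode_eq, fstF_boolPair, encodingIntMatrix_encode_eq, sndF_boolPair, sndF_boolPair,
    elemOf_body, List.getD_eq_getElem _ _ (by simpa using hk)]
  simp [sign_flatEntry hJ]

/-- The parse of a codeword: threshold. [folklore] -/
theorem thrOf_isingCode (n : ℕ) (J : Matrix (Fin n) (Fin n) ℤ) (K : ℤ) : thrOf (isingCode (⟨n, J⟩, K)) = K := by
  rw [thrOf, isingCode_eq, sndF_boolPair, smval_encode]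

/-- **Codewords of unit-coupling instances are fixed by the re-encoder.** [folklore] -/
theorem reencF_isingCode {n : ℕ} {J : Matrix (Fin n) (Fin n) ℤ} (hJ : IsUnitCoupling J) (K : ℤ) :
    reencF (isingCode (⟨n, J⟩, K)) = isingCode (⟨n, J⟩, K) := by
  rw [reencF, fanoutFn_apply, matCodeF_apply', thrCodeF_apply, thrOf_isingCode, dimOf_isingCode]
  conv_rhs => rw [isingCode_eq, encodingIntMatrix_encode_eq]
  congr 4
  exact List.map_congr_left fun k hk => by rw [entryOf_isingCode hJ K (List.mem_range.1 hk)]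

/-- Transport of a ground-state witness along an equality of instances. [folklore] -/
theorem exists_energy_le_of_sigma_eq {p q : Σ n, Matrix (Fin n) (Fin n) ℤ} (h : p = q) (K : ℤ) :
    (∃ σ, isingEnergy p.2 σ ≤ K) → ∃ σ, isingEnergy q.2 σ ≤ K := by
  subst h; exact id

/-- **Membership in `ISINGGROUND`, read through the parse**: `x` is a yes-codeword iff it is fixed by
the re-encoder and its parsed instance has a configuration of energy `≤ K'`. [folklore] -/
theorem mem_ISINGGROUND_iff (x : List Bool) :
    x ∈ ISINGGROUND ↔ reencF x = x ∧ ∃ σ : Fin (dimOf x) → Bool, isingEnergy (matOf x) σ ≤ thrOf x := by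
  constructor
  · rintro ⟨⟨⟨n, J⟩, K⟩, ⟨hJ, hσ⟩, rfl⟩
    have hre : reencF (isingCode (⟨n, J⟩, K)) = isingCode (⟨n, J⟩, K) := reencF_isingCode hJ K
    refine ⟨hre, ?_⟩
    rw [reencF_apply] at hre
    have hinj := (encodingIntMatrix.pairBool encodingIntBool).encode_injective hre
    simp only [Prod.mk.injEq] at hinj
    obtain ⟨h12, h3⟩ := hinj
    change ∃ σ, isingEnergy (matOf (isingCode (⟨n, J⟩, K))) σ ≤ thrOf (isingCode (⟨n, J⟩, K))
    rw [h3]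
    exact exists_energy_le_of_sigma_eq h12.symm K hσ
  · rintro ⟨hre, hσ⟩
    rw [← hre, reencF_apply]
    exact (Encoding.mem_toLanguage_iff _ _ _).2 ⟨isUnitCoupling_matOf x, hσ⟩

/-- A string not fixed by the re-encoder is not in `ISINGGROUND`. [folklore] -/
theorem not_mem_ISINGGROUND_of_ne {x : List Bool} (h : reencF x ≠ x) : x ∉ ISINGGROUND := fun hx =>
  h ((mem_ISINGGROUND_iff x).1 hx).1

/-! ### The query and the decision -/

/-- **The query** `⟨code ⟨n', J'⟩, ⟨1^{3|x|+3}, 1³⟩⟩`: the thermal energy of the parsed instance at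
inverse temperature `3|x| + 3`, accuracy `1/4`. [cite: TroyerWiese2005, Letter p. 4] -/
def igQryF : List Bool → List Bool :=
  fanoutFn matCodeF (fanoutFn (Plumb.polyFn (3 * X + 3)) fun _ => [true, true, true])

/-- **Value of the query**: a legal thermal query, on EVERY input. [folklore] -/
theorem igQryF_apply (x : List Bool) :
    igQryF x = thermalQuery ⟨dimOf x, matOf x⟩ (3 * x.length + 3) 3 := by
  rw [thermalQuery, igQryF, fanoutFn_apply, fanoutFn_apply, matCodeF_apply, Plumb.polyFn_apply,
    OracleCompose.unaryEncodeNat_eq_replicate, OracleCompose.unaryEncodeNat_eq_replicate]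
  simp [ones]

/-- `igQryF ∈ FP`. [folklore] -/
theorem igQryF_mem_FP : igQryF ∈ FP :=
  fanoutFn_mem_FP matCodeF_mem_FP (fanoutFn_mem_FP (Plumb.polyFn_mem_FP _) (const_mem_FP _))

/-- The bound `4K' + 2` as a canonical difference pair. [folklore] -/
def boundF : List Bool → List Bool :=
  zaddF ∘ fanoutFn (zmulF ∘ fanoutFn (fun _ => dpEnc 4) (ofSMFn ∘ sndF)) fun _ => dpEnc 2

/-- Value of `boundF`. [folklore] -/
@[simp] theorem boundF_apply (x : List Bool) : boundF x = dpEnc (4 * thrOf x + 2) := by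
  simp [boundF, thrOf]

/-- `boundF ∈ FP`. [folklore] -/
theorem boundF_mem_FP : boundF ∈ FP :=
  comp_mem_FP zaddF_mem_FP (fanoutFn_mem_FP (comp_mem_FP zmulF_mem_FP
    (fanoutFn_mem_FP (const_mem_FP _) (comp_mem_FP ofSMFn_mem_FP sndF_mem_FP))) (const_mem_FP _))

/-- **The codeword test** `[reencF x = x]` (string equality `eqPairFn`). [folklore] -/
def isCodeF : List Bool → List Bool := eqPairFn ∘ fanoutFn reencF id

/-- Value of the codeword test. [folklore] -/
@[simp] theorem isCodeF_apply (x : List Bool) : isCodeF x = [decide (reencF x = x)] := by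
  simp [isCodeF, eqPairFn_boolPair]

/-- The codeword test is one-bit. [folklore] -/
theorem oneBit_isCodeF : OneBit isCodeF := fun x => ⟨_, isCodeF_apply x⟩

/-- `isCodeF ∈ FP`. [folklore] -/
theorem isCodeF_mem_FP : isCodeF ∈ FP := comp_mem_FP eqPairFn_mem_FP (fanoutFn_mem_FP reencF_mem_FP id_mem_FP)

/-- **The decision** on `⟨x, a⟩` (`a` the oracle's answer string, read totally in sign–magnitude):
codeword test AND `[smval a ≤ 4K' + 2]` (i.e. `a/4 < K' + 3/4`). [cite: TroyerWiese2005, Letter p. 4] -/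
def igDecF : List Bool → List Bool :=
  andFn (isCodeF ∘ fstF) (zleF ∘ fanoutFn (ofSMFn ∘ sndF) (boundF ∘ fstF))

/-- **Value of the decision.** [folklore] -/
theorem igDecF_boolPair (x a : List Bool) :
    igDecF (boolPair x a) = [decide (reencF x = x) && decide (smval a ≤ 4 * thrOf x + 2)] := by
  rw [igDecF, andFn_apply (b := decide (reencF x = x)) (b' := decide (smval a ≤ 4 * thrOf x + 2))]
  · simp
  · simp

/-- The decision is one-bit. [folklore] -/
theorem oneBit_igDecF : OneBit igDecF := oneBit_andFn (oneBit_isCodeF.comp _) (oneBit_zleF.comp _)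

/-- `igDecF ∈ FP`. [folklore] -/
theorem igDecF_mem_FP : igDecF ∈ FP :=
  andFn_mem_FP (comp_mem_FP isCodeF_mem_FP fstF_mem_FP) (comp_mem_FP zleF_mem_FP
    (fanoutFn_mem_FP (comp_mem_FP ofSMFn_mem_FP sndF_mem_FP) (comp_mem_FP boundF_mem_FP fstF_mem_FP)))

/-! ### The one-query oracle algorithm -/

section Alg

open PRelSigma TTClosure

/-- **The oracle algorithm**: on input `x` ask `igQryF x`, then output the decision on the answer.
[cite: TroyerWiese2005, Letter p. 4] -/
def igAlg : OracleAlg Bool where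
  step x ans := if ans.length < 1 then Sum.inl (igQryF x) else Sum.inr ((igDecF (boolPair x (ans.headD []))).headD false)

/-- The step on the empty transcript is the query. [folklore] -/
theorem igAlg_step_nil (x : List Bool) : igAlg.step x [] = Sum.inl (igQryF x) := rfl

/-- The step after an answer is the verdict. [folklore] -/
theorem igAlg_step_cons (x a : List Bool) (rest : List (List Bool)) :
    igAlg.step x (a :: rest) = Sum.inr ((igDecF (boolPair x a)).headD false) := by
  simp [igAlg]

/-- **The run**: with at least two rounds, `igAlg` outputs the decision on the oracle's answer to its
single query. [folklore] -/
theorem run_igAlg (O : Oracle) (x : List Bool) {k : ℕ} (hk : 1 < k) :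
    igAlg.run O k x = some ((igDecF (boolPair x (O (igQryF x)))).headD false) := by
  have h0 : trans igAlg O x 0 = [] := rfl
  have h1 : trans igAlg O x 1 = [O (igQryF x)] := by
    rw [trans_succ, h0, qryOf_eq_of_step_eq (igAlg_step_nil x)]
    rfl
  rw [run_eq_some_iff]
  refine ⟨1, hk, fun i hi => ?_, ?_⟩
  · obtain rfl : i = 0 := by omega
    exact ⟨igQryF x, by rw [h0, igAlg_step_nil]⟩
  · rw [h1, igAlg_step_cons]

/-- **The queries**: every recorded query of `igAlg` is `igQryF x`. [folklore] -/
theorem eq_of_mem_queries_igAlg (O : Oracle) (x : List Bool) (k : ℕ) {y : List Bool}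
    (hy : y ∈ igAlg.queries O k x) : y = igQryF x := by
  obtain ⟨i, -, hall, rfl⟩ := exists_of_mem_queries _ _ k x y hy
  have h0 : trans igAlg O x 0 = [] := rfl
  have h1 : trans igAlg O x 1 = [O (igQryF x)] := by
    rw [trans_succ, h0, qryOf_eq_of_step_eq (igAlg_step_nil x)]
    rfl
  rcases i with _ | i
  · rw [h0, qryOf_eq_of_step_eq (igAlg_step_nil x)]
  · obtain ⟨y', hy'⟩ := hall 1 (by omega)
    rw [h1, igAlg_step_cons] at hy'
    cases hy'

/-- The output branch of the step as a string map: `1 · igDecF ⟨x, first answer⟩`. [folklore] -/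
def igOutB : List Bool → List Bool :=
  List.cons true ∘ igDecF ∘ pairFn fstP (fstP ∘ bodA)

/-- **The step of `igAlg` as a string map.** [folklore] -/
def igStepB : List Bool → List Bool :=
  condFn (GoOn 1) (qryS (igQryF ∘ fstP)) igOutB

/-- `igOutB ∈ FP`. [folklore] -/
theorem igOutB_mem_FP : igOutB ∈ FP :=
  comp_mem_FP (cons_mem_FP true) (comp_mem_FP igDecF_mem_FP
    (pairFn_mem_FP fstP_mem_FP (comp_mem_FP fstP_mem_FP bodA_mem_FP)))

/-- `igStepB ∈ FP`. [folklore] -/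
theorem igStepB_mem_FP : igStepB ∈ FP :=
  condFn_mem_FP (GoOn_mem_P 1) (qryS_mem_FP (comp_mem_FP igQryF_mem_FP fstP_mem_FP)) igOutB_mem_FP

/-- The output branch on a coded pair. [folklore] -/
theorem igOutB_apply (x : List Bool) (ans : List (List Bool)) :
    igOutB (boolPair x ((encodingList Bool).listBool.encode ans)) = true :: igDecF (boolPair x (ans.headD [])) := by
  rw [igOutB, Function.comp_apply, Function.comp_apply, pairFn_apply, fstP_boolPair, Function.comp_apply, bodA_apply]
  cases ans with
  | nil => rfl
  | cons a rest => rw [body_cons, fstP_boolPair]; rfl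

/-- **The string map computes the step function.** [folklore] -/
theorem igStepB_apply (x : List Bool) (ans : List (List Bool)) :
    igStepB (boolPair x ((encodingList Bool).listBool.encode ans)) = stepCode (igAlg.step x ans) := by
  by_cases h : ans.length < 1
  · have hnil : ans = [] := List.eq_nil_of_length_eq_zero (by omega)
    subst hnil
    rw [igStepB, condFn_of_mem _ _ ((mem_GoOn_iff x []).2 (by simp)), qryS_apply, igAlg_step_nil, stepCode_inl,
      Function.comp_apply, fstP_boolPair]
  · have hne : ans ≠ [] := by rintro rfl; simp at h
    obtain ⟨a, rest, rfl⟩ := List.exists_cons_of_ne_nil hne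
    rw [igStepB, condFn_of_not_mem _ _ (fun h' => h (by simpa using (mem_GoOn_iff x _).1 h')), igOutB_apply,
      igAlg_step_cons, stepCode_inr]
    obtain ⟨b, hb⟩ := oneBit_igDecF (boolPair x a)
    simp [hb]

/-- **`igAlg` is polynomial-time.** [folklore] -/
theorem isPolyTime_igAlg : igAlg.IsPolyTime encodingBoolBool := by
  obtain ⟨p, Mx, h⟩ := igStepB_mem_FP
  refine ⟨p, Mx, fun z => ?_⟩
  have hz := h (boolPair z.1 ((encodingList Bool).listBool.encode z.2))
  rw [id, igStepB_apply] at hz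
  exact hz

end Alg

end IsingCode

/-! ### Troyer–Wiese's reduction step for the matrix-coded language: `signProblem_decides_isingGround_holds`

The language `ISINGGROUND` of `SignProblemNPHard.lean` is the image of the yes-instances under the
instance encoding; the one-query machine `IsingCode.igAlg` of `SignProblemNPHardIsingGround.lean` asks
the thermal energy of the PARSED instance `⟨dimOf x, matOf x⟩` (unit couplings on every input, so the
query is always legal) at `β = 3|x| + 3 ≥ 3 n' + 3` with accuracy `1/4`, and accepts iff `x` is a
codeword (`reencF x = x`) and the answer `a` has `a ≤ 4 K' + 2`. -/

section IsingGround

open IsingCode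

/-- **The decision on a thermal oracle's answer decides `ISINGGROUND`**: Troyer–Wiese's
low-temperature lemma (`lowTemperature_thermalEnergy_decides_holds`, `E₀ = thrOf x`, `β = 3|x| + 3`,
accuracy `1/4`) for the parsed instance, and the codeword characterisation `mem_ISINGGROUND_iff`.
[cite: TroyerWiese2005, Letter p. 4] -/
theorem igVerdict_eq_boolIndicator (O : Oracle) (hO : IsIsingThermalOracle O) (x : List Bool) :
    (igDecF (boolPair x (O (igQryF x)))).headD false = (ISINGGROUND : Set (List Bool)).boolIndicator x := by
  rw [igQryF_apply]
  obtain ⟨a, ha, hacc⟩ := hO ⟨dimOf x, matOf x⟩ (3 * x.length + 3) 3 (isUnitCoupling_matOf x)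
  rw [ha, igDecF_boolPair, smval_encode, List.headD_cons]
  have key : a ≤ 4 * thrOf x + 2 ↔ ∃ σ, isingEnergy (matOf x) σ ≤ thrOf x := by
    have hβ : (dimOf x : ℝ) * Real.log 2 + Real.log (12 * (dimOf x : ℕ)) ≤ ((3 * x.length + 3 : ℕ) : ℝ) := by
      rcases Nat.eq_zero_or_pos (dimOf x) with h0 | hpos
      · rw [h0]; simp; positivity
      · refine (lowTemperature_le _ hpos).trans ?_
        have : dimOf x ≤ x.length := Nat.min_le_right _ _
        exact_mod_cast (by omega : 3 * dimOf x + 3 ≤ 3 * x.length + 3)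
    have hlow := lowTemperature_thermalEnergy_decides_holds (dimOf x) (matOf x) (thrOf x)
      ((3 * x.length + 3 : ℕ) : ℝ) (isUnitCoupling_matOf x) hβ
    have hacc' : |(a : ℝ) / 4 - isingThermalEnergy (matOf x) ((3 * x.length + 3 : ℕ) : ℝ)| ≤ 1 / 4 := by
      norm_num at hacc ⊢
      exact hacc
    obtain ⟨hup, hdown⟩ := abs_sub_le_iff.1 hacc'
    push_cast at hup hdown hlow
    constructor
    · intro hle
      by_contra hno
      push Not at hno
      have h2 := hlow.2 hno
      have : (4 : ℝ) * (thrOf x : ℝ) + 3 ≤ a := by linarith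
      have : 4 * thrOf x + 3 ≤ a := by exact_mod_cast this
      omega
    · rintro hex
      have h1 := hlow.1 hex
      have : (a : ℝ) < 4 * (thrOf x : ℝ) + 3 := by linarith
      have : a < 4 * thrOf x + 3 := by exact_mod_cast this
      omega
  by_cases hre : reencF x = x
  · have hiff : x ∈ ISINGGROUND ↔ ∃ σ, isingEnergy (matOf x) σ ≤ thrOf x :=
      (mem_ISINGGROUND_iff x).trans ⟨fun h => h.2, fun h => ⟨hre, h⟩⟩
    by_cases hx : x ∈ ISINGGROUND
    · rw [(Set.mem_iff_boolIndicator _ _).1 hx, decide_eq_true hre, decide_eq_true (key.2 (hiff.1 hx))]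
      rfl
    · rw [(Set.notMem_iff_boolIndicator _ _).1 hx, decide_eq_true hre,
        decide_eq_false (fun h => hx (hiff.2 (key.1 h)))]
      rfl
  · rw [(Set.notMem_iff_boolIndicator _ _).1 (not_mem_ISINGGROUND_of_ne hre), decide_eq_false hre]
    rfl

/-- **`ISINGGROUND ∈ P^O` for every thermal-energy oracle `O`** (round budget `s + 2`, the single
query `igQryF x` of length `≤ s(|x|)`). [cite: TroyerWiese2005, Letter p. 4] -/
theorem isingGround_mem_PRel (O : Oracle) (hO : IsIsingThermalOracle O) : ISINGGROUND ∈ PRel O := by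
  obtain ⟨s, hs⟩ := exists_poly_length_le_of_mem_FP igQryF_mem_FP
  refine ⟨igAlg, isPolyTime_igAlg, s + 2, fun x => ⟨?_, fun y hy => ?_⟩⟩
  · rw [run_igAlg O x (by simp [eval_add]; omega), igVerdict_eq_boolIndicator O hO x]
  · rw [eq_of_mem_queries_igAlg O x _ hy]
    exact (hs x).trans (by simp)

/-- **Troyer–Wiese's reduction step — discharged**: with access to thermal energies of unit-coupling
Ising systems (`IsIsingThermalOracle O`, "a solution of the sign problem" for their family) the
matrix-coded `NP`-complete Ising ground-state language `ISINGGROUND` is decidable in polynomial time,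
`ISINGGROUND ∈ P^O`: one query at `β = 3|x| + 3 ≥ n ln 2 + ln(12 n)` and accuracy `1/4`, compared with
`E₀ + 3/4` (Troyer–Wiese: "by choosing an inverse temperature `βJ ≥ N ln 2 + ln(12N)` the thermal
average of the energy will be less than `E₀ + J/2` if at least one configuration with energy `E₀` or
less exists, and larger than `E₀ + J` otherwise"), after recognising the codeword by re-encoding its
total parse (`SignProblemNPHardIsingGround.lean`). [cite: TroyerWiese2005, Letter p. 4] -/
theorem signProblem_decides_isingGround_holds : signProblem_decides_isingGround :=
  isingGround_mem_PRel

/-- With Barahona's `NP`-completeness of `ISINGGROUND` (the remaining named fact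
`isingGround_isNPComplete`) the barrier also follows along Troyer–Wiese's own route
(`SignProblemNPHard.of_facts`), all other inputs being proved. [cite: TroyerWiese2005, Letter p. 4] -/
theorem SignProblemNPHard.of_isingGround_isNPComplete (hNP : isingGround_isNPComplete) : SignProblemNPHard :=
  SignProblemNPHard.of_facts signProblem_decides_isingGround_holds hNP PolyTimeKarpReducible.turing_holds
    mem_PRel_of_polyTimeTuringReducible_holds

end IsingGround

end Literature.Barriers.HubbardSuperconductivity

end
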